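import Mathlib.NumberTheory.AbelSummation
import Literature.NumberTheory.Sieve.LevelOfDistributionProofs
import Literature.NumberTheory.Sieve.BombieriVinogradovReduction
import Literature.NumberTheory.Sieve.BombieriFriedlanderIwaniec
import HarnessLib

/-!
# Proofs for `BombieriFriedlanderIwaniec`: the `ψ`-form of BFI Theorem 10 from the `π`-form

Topic `Literature/NumberTheory/Sieve`, proofs companion of
`Literature.NumberTheory.Sieve.BombieriFriedlanderIwaniec` (the vendored forms of
Bombieri–Friedlander–Iwaniec, Acta Math. 156 (1986), Theorem 10) for the named fact
`Literature.bfi_wellFactorable_level = PrimesHaveWellFactorableLevel (4/7)` of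
`Literature.NumberTheory.Sieve.LevelOfDistribution`.  The unweighted analogue — the equivalence
`PrimesHaveLevel θ ↔ PrimesHaveLevelPi θ` of the `ψ`- and `π`-forms of a level of distribution with
`max_{(a,q)=1}` — is `Literature.NumberTheory.Sieve.LevelOfDistributionProofs` (imported); the present
file treats sums weighted by well-factorable `λ(q)` at a FIXED residue `a`, where the weights change
sign and the passage goes through an integral `∫_2^x B(t) dt/t` of the weighted `π`-sum `B(t)` at all
heights `t ≤ x` rather than through a maximum over `y ≤ x`.  Shared inputs taken from the tree (not
re-proved here): the averaged prime-power bound `∑_{q ≤ Q} max_{(b,q)=1} ∑_{n ≤ x, n non-prime, n ≡ b (q)} Λ(n)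
≪ x/(log x)^A` for `Q ≤ x^{1−ε}` (`Literature.NumberTheory.Sieve.eventually_sum_iSup_chebyshevPsiModNotPrime_le`,
`LevelOfDistributionProofs` / `PrimePowersInProgressions`), the residue-class count
`#{n ≤ X : n ≡ t (q)} ≤ X/q + 1` (`Literature.NumberTheory.Sieve.card_range_filter_natCast_eq_le`, `PrimePowersInProgressions`),
and the harmonic-type sums `∑_{q ≤ Q} 1/q ≤ 1 + log Q`, `∑_{q ≤ Q} 1/φ(q) ≤ (1 + log Q)²`
(`Literature.NumberTheory.Sieve.harmonic_Icc_le`, `Literature.NumberTheory.Sieve.totientInvSum_le`, `BombieriVinogradovReduction`).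

## Main results

* `Literature.bfi_wellFactorable_level_of_theorem10Pi :
    BombieriFriedlanderIwaniecTheorem10Pi → ChebyshevThetaDeLaValleePoussin → bfi_wellFactorable_level`.
* `Literature.NumberTheory.Sieve.isWellFactorable_iff_bfi`: for `Q ≥ 1`, the tree's `IsWellFactorable Q λ` is equivalent to
  the clause printed in BFI 1986, §1 (faithfulness of the vendored notion).

`bfi_wellFactorable_level` is the `ψ`-FORM (`∑_q λ_x(q)(ψ(x; q, a) − x/φ(q)) ≪ x/(log x)^A` for
families `λ_x` well-factorable of level `x^{4/7−ε}`); this is the form printed in BFI 1986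
(vendored verbatim, uniform in `λ`, as `BombieriFriedlanderIwaniecTheorem10` in
`Literature.NumberTheory.Sieve.BombieriFriedlanderIwaniec`, where the one-line passage
`bfi_wellFactorable_level_of_theorem10` is proved).  The modern restatements (Maynard,
arXiv:2006.07088, p. 3; Lichtman, arXiv:2309.08522, (1.3)) print instead the `π`-FORM with expected
value `π(x)/φ(q)`, uniform in `λ` and in the level `Q ≤ x^{4/7−ε}`
(`BombieriFriedlanderIwaniecTheorem10Pi`, same file).  This file proves the standard
partial-summation passage from the `π`-form to the `ψ`-form (Iwaniec–Kowalski §17.1), so that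
`bfi_wellFactorable_level` also follows from the `π`-form together with the prime number theorem
with the de la Vallée Poussin error term (`ChebyshevThetaDeLaValleePoussin`, Montgomery–Vaughan
Thm 6.9, vendored in `Literature.NumberTheory.LFunctions.PrimeNumberTheoremErrorTerm`).  Proving
BFI Theorem 10 itself (dispersion method, Deshouillers–Iwaniec bounds for sums of Kloosterman
sums, Heath-Brown's identity) is far beyond Mathlib today.

## The argument (`namespace Literature.BFIReduction`)

For `x ≥ 2` and moduli `q ≤ Qn`, `(q, a) = 1`, Abel summation gives the exact identity
(`weighted_sum_eq`)
`∑_q λ(q)(ψ(x;q,a) − x/φ(q)) = B(x) log x − ∫_2^x B(t) dt/t + (ϑ(x) − x) ∑_q λ(q)/φ(q) + ∑_q λ(q) PP_q(x)`,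
where `B(t) = ∑_q λ(q)(π(t;q,a) − π(t)/φ(q))` (`bfiSum`) is the BFI sum at height `t` and `PP_q(x)`
is the contribution of the proper prime powers `≡ a (mod q)`.  With `Qn = ⌊x^{4/7−ε}⌋`:
* `B(x)` and `B(t)` for `x^{1−ε/2} ≤ t ≤ x` are `≪ t/(log x)^{A+1}` by BFI Theorem 10 with `(A+1, ε/2)`
  (`rpow_level_le_rpow`: `x^{4/7−ε} ≤ t^{4/7−ε/2}` there); below `x^{1−ε/2}` the trivial bound
  `|B(t)| ≤ 2t(1 + log Qn)² + Qn` (`abs_bfiSum_le_trivial`) suffices (`abs_integral_bfiSum_div_le`);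
* `|ϑ(x) − x| ∑_{q ≤ Qn} 1/φ(q) ≤ C x (1 + log x)²/(log x)^{A+2}` (`Literature.NumberTheory.Sieve.totientInvSum_le` and
  the PNT);
* `|∑_q λ(q) PP_q(x)| ≤ ∑_{q ≤ Qn} max_{(b,q)=1} PP_{q,b}(x) ≤ x/(log x)^A`, since `(q, a) = 1` for the
  moduli in the sum and `Qn ≤ x^{4/7} = x^{1−3/7}` (`Literature.NumberTheory.Sieve.eventually_sum_iSup_chebyshevPsiModNotPrime_le`
  with `ε = 3/7`; here `PP_{q,b}(x) = chebyshevPsiModNotPrime q b ⌊x⌋`).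

## References

* E. Bombieri, J. B. Friedlander, H. Iwaniec, *Primes in arithmetic progressions to large moduli*,
  Acta Math. 156 (1986), 203–251, Theorem 10.
* H. Iwaniec, E. Kowalski, *Analytic Number Theory*, AMS Coll. Publ. 53 (2004), §17.1.
* H. L. Montgomery, R. C. Vaughan, *Multiplicative Number Theory I*, CUP 2007, Theorem 6.9.
-/

open Filter Asymptotics Finset Real MeasureTheory

namespace Literature.NumberTheory.Sieve

/-! ### Faithfulness of `IsWellFactorable` (BFI 1986, §1, Definition) -/

/-- **The tree's `IsWellFactorable` is BFI's printed notion.** Bombieri–Friedlander–Iwaniec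
(Acta Math. 156 (1986), §1, Definition, p. 208) call `λ` well factorable of level `Q` iff
for all `Q₁, Q₂ ≥ 1` with `Q₁ Q₂ = Q` there are `λ₁, λ₂` supported in `[1, Q₁]`, `[1, Q₂]` with
`|λ₁|, |λ₂| ≤ 1` and `λ = λ₁ ⋆ λ₂`; `IsWellFactorable Q λ` records in addition `|λ| ≤ 1`, `λ(0) = 0`
and `λ(n) = 0` for `n > Q`.  For `Q ≥ 1` the two agree: the factorisation with `Q₁ = Q`, `Q₂ = 1`
has `λ₂` supported on `{1}`, so `λ(n) = λ₁(n) λ₂(1)` for `n ≥ 1` and `λ(0) = (λ₁ ⋆ λ₂)(0) = 0`.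
(For `Q < 1` BFI's clause is vacuous while ours forces `λ = 0`; levels `< 1` never occur.)
[cite: BombieriFriedlanderIwaniecActa1986, §1 Definition (p. 208)] -/
theorem isWellFactorable_iff_bfi {Q : ℝ} (hQ : 1 ≤ Q) (lam : ℕ → ℝ) :
    IsWellFactorable Q lam ↔
      ∀ Q₁ Q₂ : ℝ, 1 ≤ Q₁ → 1 ≤ Q₂ → Q₁ * Q₂ = Q →
        ∃ α β : ArithmeticFunction ℝ,
          (∀ n, |α n| ≤ 1) ∧ (∀ n, |β n| ≤ 1) ∧
          (∀ n : ℕ, Q₁ < n → α n = 0) ∧ (∀ n : ℕ, Q₂ < n → β n = 0) ∧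
          ∀ n, lam n = (α * β) n := by
  refine ⟨fun h => h.2.2.2, fun h => ?_⟩
  obtain ⟨α, β, hα, hβ, hαs, hβs, hlam⟩ := h Q 1 hQ le_rfl (mul_one Q)
  -- with `β` supported on `{0, 1}` (and `β 0 = 0`), `λ(n) = α(n) β(1)` for `n ≥ 1`
  have hkey : ∀ n : ℕ, n ≠ 0 → lam n = α n * β 1 := by
    intro n hn
    rw [hlam n, ArithmeticFunction.mul_apply]
    refine Finset.sum_eq_single (n, 1) (fun p hp hne => ?_) (fun hmem => ?_)
    · rw [Nat.mem_divisorsAntidiagonal] at hp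
      have hp2 : p.2 ≠ 1 := by
        rintro h2
        apply hne
        have h1 : p.1 = n := by rw [← hp.1, h2, mul_one]
        exact Prod.ext h1 h2
      have hp2' : p.2 ≠ 0 := by
        rintro h0
        exact hp.2 (by rw [← hp.1, h0, mul_zero])
      rw [hβs p.2 (by exact_mod_cast (show 1 < p.2 by omega)), mul_zero]
    · exact absurd (Nat.mem_divisorsAntidiagonal.mpr ⟨mul_one n, hn⟩) hmem
  refine ⟨fun n => ?_, by rw [hlam 0]; simp, fun n hn => ?_, h⟩
  · rcases eq_or_ne n 0 with rfl | hn
    · rw [hlam 0]; simp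
    · rw [hkey n hn, abs_mul]
      exact mul_le_one₀ (hα n) (abs_nonneg _) (hβ 1)
  · have hn0 : n ≠ 0 := by
      rintro rfl
      exact absurd (hQ.trans_lt (by exact_mod_cast hn)) (by norm_num)
    rw [hkey n hn0, hαs n hn, zero_mul]

namespace BFIReduction

/-! ### The pieces of `ψ(x; q, a)`: primes (the proper prime powers are the tree's
`chebyshevPsiModNotPrime q a ⌊x⌋`, `LevelOfDistributionProofs`) -/

/-- The indicator of the primes `p ≡ a (mod q)` (as a real sequence). [folklore] -/
noncomputable def primeInd (q : ℕ) (a : ZMod q) (n : ℕ) : ℝ :=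
  if (n : ZMod q) = a ∧ n.Prime then 1 else 0

/-- `π(t; q, a) = #{p ≤ t : p ≡ a (mod q)}` as a real number, written as the partial sum of
`primeInd` over `0 ≤ n ≤ ⌊t⌋` (the shape produced by Mathlib's Abel summation). [folklore] -/
noncomputable def piMod (q : ℕ) (a : ZMod q) (t : ℝ) : ℝ :=
  ∑ n ∈ Icc 0 ⌊t⌋₊, primeInd q a n

/-- `ϑ(x; q, a) = ∑_{p ≤ x, p ≡ a (q)} log p`. [folklore] -/
noncomputable def thetaMod (q : ℕ) (a : ZMod q) (x : ℝ) : ℝ :=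
  ∑ n ∈ Icc 0 ⌊x⌋₊, Real.log n * primeInd q a n

/-- `0 ≤ primeInd`. [folklore] -/
theorem primeInd_nonneg (q : ℕ) (a : ZMod q) (n : ℕ) : 0 ≤ primeInd q a n := by
  unfold primeInd; split_ifs <;> norm_num

/-- `primeInd ≤ 1`. [folklore] -/
theorem primeInd_le_one (q : ℕ) (a : ZMod q) (n : ℕ) : primeInd q a n ≤ 1 := by
  unfold primeInd; split_ifs <;> norm_num

/-- `piMod` is the cardinality of the primes `p ≤ t`, `p ≡ a (q)`. [folklore] -/
theorem piMod_eq_card (q : ℕ) (a : ZMod q) (t : ℝ) :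
    piMod q a t = #((range (⌊t⌋₊ + 1)).filter fun n : ℕ => (n : ZMod q) = a ∧ n.Prime) := by
  rw [piMod, ← Nat.range_succ_eq_Icc_zero]
  unfold primeInd
  rw [Finset.sum_boole]

/-- `piMod` agrees with the prelude's `primeCountingMod` at the least nonnegative residue of an
integer `a`. [folklore] -/
theorem piMod_intCast_eq_primeCountingMod {q : ℕ} (hq : q ≠ 0) (a : ℤ) (t : ℝ) :
    piMod q (a : ZMod q) t = LevelOfDistribution.primeCountingMod q (a : ZMod q).val ⌊t⌋₊ := by
  haveI : NeZero q := ⟨hq⟩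
  rw [piMod_eq_card, LevelOfDistribution.primeCountingMod]
  congr 2
  ext n
  simp only [Finset.mem_filter, and_congr_right_iff]
  intro _
  rw [and_comm, and_congr_right_iff]
  intro _
  rw [← ZMod.natCast_eq_natCast_iff, ZMod.natCast_zmod_val]

/-- `0 ≤ π(t; q, a)`. [folklore] -/
theorem piMod_nonneg (q : ℕ) (a : ZMod q) (t : ℝ) : 0 ≤ piMod q a t :=
  Finset.sum_nonneg fun n _ => primeInd_nonneg q a n

/-- `t ↦ π(t; q, a)` is monotone. [folklore] -/
theorem piMod_mono (q : ℕ) (a : ZMod q) : Monotone (piMod q a) := by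
  intro s t hst
  exact Finset.sum_le_sum_of_subset_of_nonneg (Finset.Icc_subset_Icc le_rfl (Nat.floor_le_floor hst))
    fun n _ _ => primeInd_nonneg q a n

/-- Trivial bound: `π(t; q, a) ≤ t/q + 1` for `q ≥ 1`, `t ≥ 0`. [folklore] -/
theorem piMod_le (q : ℕ) (a : ZMod q) {t : ℝ} (ht : 0 ≤ t) :
    piMod q a t ≤ t / q + 1 := by
  rw [piMod_eq_card]
  have h1 : #((range (⌊t⌋₊ + 1)).filter fun n : ℕ => (n : ZMod q) = a ∧ n.Prime) ≤
      #((range (⌊t⌋₊ + 1)).filter fun n : ℕ => (n : ZMod q) = a) :=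
    Finset.card_le_card (Finset.monotone_filter_right _ fun n _ h => h.1)
  have h2 := card_range_filter_natCast_eq_le q a ⌊t⌋₊
  have h3 : ((⌊t⌋₊ / q : ℕ) : ℝ) ≤ t / q :=
    Nat.cast_div_le.trans (div_le_div_of_nonneg_right (Nat.floor_le ht) (Nat.cast_nonneg q))
  calc (#((range (⌊t⌋₊ + 1)).filter fun n : ℕ => (n : ZMod q) = a ∧ n.Prime) : ℝ)
      ≤ ((⌊t⌋₊ / q + 1 : ℕ) : ℝ) := by exact_mod_cast h1.trans h2
    _ ≤ t / q + 1 := by push_cast; linarith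

/-- Trivial bound: `π(t; q, a) ≤ t + 1`. [folklore] -/
theorem piMod_le' (q : ℕ) (a : ZMod q) {t : ℝ} (ht : 0 ≤ t) : piMod q a t ≤ t + 1 := by
  calc piMod q a t ≤ ∑ n ∈ Icc 0 ⌊t⌋₊, (1 : ℝ) := Finset.sum_le_sum fun n _ => primeInd_le_one q a n
    _ = ⌊t⌋₊ + 1 := by simp
    _ ≤ t + 1 := by linarith [Nat.floor_le ht]

/-- Trivial bound: `π(N) ≤ N`. [folklore] -/
theorem primeCounting_le_self (N : ℕ) : Nat.primeCounting N ≤ N := by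
  rw [Nat.primeCounting, ← Nat.primesBelow_card_eq_primeCounting']
  calc #(N + 1).primesBelow ≤ #(Icc 1 N) := by
        refine Finset.card_le_card fun p hp => ?_
        rw [Nat.primesBelow, Finset.mem_filter, Finset.mem_range] at hp
        rw [Finset.mem_Icc]
        exact ⟨hp.2.one_lt.le, Nat.le_of_lt_succ hp.1⟩
    _ = N := by simp

/-- `ψ(x; q, a) = ϑ(x; q, a) + (proper prime powers ≤ x, ≡ a (q))`, the last term being the tree's
`chebyshevPsiModNotPrime q a ⌊x⌋ = ∑_{n ≤ ⌊x⌋, n not prime} 1_{n ≡ a (q)} Λ(n)`. [folklore] -/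
theorem chebyshevPsiMod_eq_thetaMod_add (q : ℕ) (a : ZMod q) (x : ℝ) :
    LevelOfDistribution.chebyshevPsiMod q a x = thetaMod q a x + chebyshevPsiModNotPrime q a ⌊x⌋₊ := by
  have h1 : LevelOfDistribution.chebyshevPsiMod q a x = LevelOfDistribution.chebyshevPsiMod q a (⌊x⌋₊ : ℕ) := by
    rw [LevelOfDistribution.chebyshevPsiMod, LevelOfDistribution.chebyshevPsiMod, Nat.floor_natCast]
  rw [h1, chebyshevPsiMod_natCast, thetaMod, chebyshevPsiModNotPrime, ← Nat.range_succ_eq_Icc_zero,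
    ← Finset.sum_add_distrib]
  refine Finset.sum_congr rfl fun n _ => ?_
  by_cases hp : n.Prime
  · have h : primeInd q a n = apIndicator q a n := by
      unfold primeInd apIndicator
      simp only [hp, and_true]
    rw [if_pos hp, h, ArithmeticFunction.vonMangoldt_apply_prime hp, add_zero, mul_comm]
  · have h : primeInd q a n = 0 := by
      unfold primeInd
      simp only [hp, and_false, if_false]
    rw [if_neg hp, h, mul_zero, zero_add]

/-- **Abel summation for `ϑ(x; q, a)`**: for `x ≥ 2`,
`ϑ(x; q, a) = π(x; q, a) log x − ∫_2^x π(t; q, a) dt/t` (as Mathlib's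
`Chebyshev.theta_eq_primeCounting_mul_log_sub_integral`, with the residue condition inserted).
[folklore] -/
theorem thetaMod_eq_piMod_mul_log_sub_integral (q : ℕ) (a : ZMod q) {x : ℝ} (hx : 2 ≤ x) :
    thetaMod q a x = piMod q a x * Real.log x - ∫ t in (2 : ℝ)..x, piMod q a t / t := by
  have h0 : primeInd q a 0 = 0 := by simp [primeInd, Nat.not_prime_zero]
  have h1 : primeInd q a 1 = 0 := by simp [primeInd, Nat.not_prime_one]
  rw [thetaMod, sum_mul_eq_sub_integral_mul₁ (primeInd q a) h0 h1 x
    (fun z ⟨hz, _⟩ => (by fun_prop (disch := linarith))) ?hint, ← intervalIntegral.integral_of_le hx]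
  case hint =>
    rw [Real.deriv_log']
    refine ContinuousOn.integrableOn_Icc ?_
    fun_prop (disch := grind)
  have int_deriv (f : ℝ → ℝ) :
      ∫ u in (2 : ℝ)..x, deriv (fun x => Real.log x) u * f u = ∫ u in (2 : ℝ)..x, f u / u :=
    intervalIntegral.integral_congr fun u _ => by rw [Real.deriv_log, mul_comm, div_eq_mul_inv]
  rw [int_deriv, mul_comm]
  rfl

/-! ### The weighted sum over the moduli and its trivial bound -/

/-- The moduli set `{1 ≤ q ≤ Qn : (q, a) = 1}`. [folklore] -/
def moduli (Qn : ℕ) (a : ℤ) : Finset ℕ :=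
  (Icc 1 Qn).filter fun q : ℕ => IsCoprime (q : ℤ) a

/-- Moduli are `≥ 1`. [folklore] -/
theorem one_le_of_mem_moduli {Qn : ℕ} {a : ℤ} {q : ℕ} (hq : q ∈ moduli Qn a) : 1 ≤ q := by
  rw [moduli, Finset.mem_filter, Finset.mem_Icc] at hq
  exact hq.1.1

/-- The moduli set is contained in `[1, Qn]`. [folklore] -/
theorem moduli_subset (Qn : ℕ) (a : ℤ) : moduli Qn a ⊆ Icc 1 Qn := Finset.filter_subset _ _

/-- The BFI sum at height `t` with moduli up to `Qn` and weights `λ`: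
`B(t) = ∑_{q ≤ Qn, (q,a)=1} λ(q) (π(t; q, a) − π(t)/φ(q))`. [folklore] -/
noncomputable def bfiSum (Qn : ℕ) (a : ℤ) (lam : ℕ → ℝ) (t : ℝ) : ℝ :=
  ∑ q ∈ moduli Qn a, lam q * (piMod q (a : ZMod q) t - (Nat.primeCounting ⌊t⌋₊ : ℝ) / q.totient)

/-- `bfiSum` is literally the sum bounded by `BombieriFriedlanderIwaniecTheorem10Pi`. [folklore] -/
theorem bfiSum_eq (Q : ℝ) (a : ℤ) (lam : ℕ → ℝ) (t : ℝ) :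
    bfiSum ⌊Q⌋₊ a lam t =
      ∑ q ∈ (Icc 1 ⌊Q⌋₊).filter (fun q : ℕ => IsCoprime (q : ℤ) a),
        lam q * ((LevelOfDistribution.primeCountingMod q (a : ZMod q).val ⌊t⌋₊ : ℝ) -
          (Nat.primeCounting ⌊t⌋₊ : ℝ) / Nat.totient q) := by
  refine Finset.sum_congr rfl fun q hq => ?_
  have hq1 : q ≠ 0 := by have := one_le_of_mem_moduli hq; omega
  rw [piMod_intCast_eq_primeCountingMod hq1]

/-- **Trivial bound** for the BFI sum: for `|λ| ≤ 1` and `t ≥ 0`,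
`|B(t)| ≤ 2 t (1 + log Qn)² + Qn`, from `π(t; q, a) ≤ t/q + 1`, `π(t) ≤ t`,
`∑_{q ≤ Qn} 1/q ≤ 1 + log Qn` (`Literature.NumberTheory.Sieve.harmonic_Icc_le`) and
`∑_{q ≤ Qn} 1/φ(q) ≤ (1 + log Qn)²` (`Literature.NumberTheory.Sieve.totientInvSum_le`). [folklore] -/
theorem abs_bfiSum_le_trivial (Qn : ℕ) (a : ℤ) {lam : ℕ → ℝ} (hlam : ∀ q, |lam q| ≤ 1) {t : ℝ}
    (ht : 0 ≤ t) : |bfiSum Qn a lam t| ≤ 2 * t * (1 + Real.log Qn) ^ 2 + Qn := by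
  have hL : 0 ≤ Real.log Qn := Real.log_natCast_nonneg Qn
  have hπ : (Nat.primeCounting ⌊t⌋₊ : ℝ) ≤ t := by
    calc (Nat.primeCounting ⌊t⌋₊ : ℝ) ≤ ⌊t⌋₊ := by exact_mod_cast primeCounting_le_self _
      _ ≤ t := Nat.floor_le ht
  have hπ0 : (0 : ℝ) ≤ Nat.primeCounting ⌊t⌋₊ := Nat.cast_nonneg _
  calc |bfiSum Qn a lam t|
      ≤ ∑ q ∈ moduli Qn a, |lam q * (piMod q (a : ZMod q) t -
          (Nat.primeCounting ⌊t⌋₊ : ℝ) / q.totient)| := Finset.abs_sum_le_sum_abs _ _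
    _ ≤ ∑ q ∈ moduli Qn a, ((t / q + 1) + t * ((q.totient : ℝ))⁻¹) := by
        refine Finset.sum_le_sum fun q hq => ?_
        have hq1 := one_le_of_mem_moduli hq
        have hφ : (0 : ℝ) < q.totient := by exact_mod_cast Nat.totient_pos.mpr hq1
        rw [abs_mul]
        refine (mul_le_of_le_one_left (abs_nonneg _) (hlam q)).trans ?_
        refine (abs_sub _ _).trans (add_le_add ?_ ?_)
        · rw [abs_of_nonneg (piMod_nonneg _ _ _)]
          exact piMod_le q _ ht
        · rw [abs_of_nonneg (div_nonneg hπ0 hφ.le), div_eq_mul_inv]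
          exact mul_le_mul_of_nonneg_right hπ (inv_nonneg.mpr hφ.le)
    _ ≤ ∑ q ∈ Icc 1 Qn, ((t / q + 1) + t * ((q.totient : ℝ))⁻¹) :=
        Finset.sum_le_sum_of_subset_of_nonneg (moduli_subset Qn a) fun q _ _ => by positivity
    _ = t * ∑ q ∈ Icc 1 Qn, (q : ℝ)⁻¹ + #(Icc 1 Qn) + t * ∑ q ∈ Icc 1 Qn, ((q.totient : ℝ))⁻¹ := by
        rw [Finset.sum_add_distrib, Finset.sum_add_distrib, Finset.mul_sum, Finset.mul_sum,
          Finset.sum_const, nsmul_eq_mul, mul_one]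
        simp [div_eq_mul_inv]
    _ ≤ t * (1 + Real.log Qn) + Qn + t * (1 + Real.log Qn) ^ 2 := by
        rw [Nat.card_Icc, Nat.add_sub_cancel]
        gcongr
        · exact Sieve.harmonic_Icc_le Qn
        · exact Sieve.totientInvSum_le Qn
    _ ≤ 2 * t * (1 + Real.log Qn) ^ 2 + Qn := by
        nlinarith [mul_nonneg ht hL, mul_nonneg (mul_nonneg ht hL) hL]

/-! ### Interval integrability of the step functions -/

/-- `t ↦ π(⌊t⌋)` is monotone. [folklore] -/
theorem monotone_primeCounting_floor :
    Monotone fun t : ℝ => (Nat.primeCounting ⌊t⌋₊ : ℝ) := fun _ _ hst =>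
  Nat.cast_le.mpr (Nat.monotone_primeCounting (Nat.floor_le_floor hst))

/-- `t ↦ (π(t; q, a) − π(t)/φ(q)) / t` is interval integrable on `[b, c] ⊆ (0, ∞)`. [folklore] -/
theorem intervalIntegrable_piMod_sub_div (q : ℕ) (a : ZMod q) {b c : ℝ} (hb : 0 < b) (hc : 0 < c) :
    IntervalIntegrable (fun t : ℝ => (piMod q a t - (Nat.primeCounting ⌊t⌋₊ : ℝ) / q.totient) / t)
      volume b c := by
  have h1 : IntervalIntegrable (fun t : ℝ => piMod q a t - (Nat.primeCounting ⌊t⌋₊ : ℝ) / q.totient)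
      volume b c := by
    refine (piMod_mono q a).intervalIntegrable.sub ?_
    simp_rw [div_eq_mul_inv]
    exact monotone_primeCounting_floor.intervalIntegrable.mul_const _
  simp_rw [div_eq_mul_inv _ (_ : ℝ)]
  refine h1.mul_continuousOn ?_
  refine continuousOn_inv₀.mono fun t ht => ?_
  rw [Set.mem_uIcc] at ht
  rw [Set.mem_compl_iff, Set.mem_singleton_iff]
  exact ne_of_gt (by rcases ht with h | h <;> linarith [h.1])

/-- `t ↦ t⁻¹` is continuous on `[b, c]` for `b, c > 0`. [folklore] -/
theorem continuousOn_inv_uIcc {b c : ℝ} (hb : 0 < b) (hc : 0 < c) :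
    ContinuousOn (fun t : ℝ => t⁻¹) (Set.uIcc b c) := by
  refine continuousOn_inv₀.mono fun t ht => ?_
  rw [Set.mem_uIcc] at ht
  rw [Set.mem_compl_iff, Set.mem_singleton_iff]
  exact ne_of_gt (by rcases ht with h | h <;> linarith [h.1])

/-- `t ↦ π(t; q, a)/t` is interval integrable on `[b, c] ⊆ (0, ∞)`. [folklore] -/
theorem intervalIntegrable_piMod_div (q : ℕ) (a : ZMod q) {b c : ℝ} (hb : 0 < b) (hc : 0 < c) :
    IntervalIntegrable (fun t : ℝ => piMod q a t / t) volume b c := by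
  simp_rw [div_eq_mul_inv]
  exact (piMod_mono q a).intervalIntegrable.mul_continuousOn (continuousOn_inv_uIcc hb hc)

/-- `t ↦ π(t)/t` is interval integrable on `[b, c] ⊆ (0, ∞)`. [folklore] -/
theorem intervalIntegrable_primeCounting_div {b c : ℝ} (hb : 0 < b) (hc : 0 < c) :
    IntervalIntegrable (fun t : ℝ => (Nat.primeCounting ⌊t⌋₊ : ℝ) / t) volume b c := by
  simp_rw [div_eq_mul_inv]
  exact monotone_primeCounting_floor.intervalIntegrable.mul_continuousOn (continuousOn_inv_uIcc hb hc)

/-- `t ↦ B(t)/t` is interval integrable on `[b, c] ⊆ (0, ∞)`. [folklore] -/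
theorem intervalIntegrable_bfiSum_div (Qn : ℕ) (a : ℤ) (lam : ℕ → ℝ) {b c : ℝ} (hb : 0 < b)
    (hc : 0 < c) : IntervalIntegrable (fun t : ℝ => bfiSum Qn a lam t / t) volume b c := by
  have h : (fun t : ℝ => bfiSum Qn a lam t / t) = ∑ q ∈ moduli Qn a, fun t : ℝ =>
      lam q * ((piMod q (a : ZMod q) t - (Nat.primeCounting ⌊t⌋₊ : ℝ) / q.totient) / t) := by
    ext t
    rw [Finset.sum_apply, bfiSum, Finset.sum_div]
    simp_rw [mul_div_assoc]
  rw [h]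
  exact IntervalIntegrable.sum _ fun q _ =>
    (intervalIntegrable_piMod_sub_div q _ hb hc).const_mul (lam q)

/-! ### The partial-summation identity -/

/-- **Per-modulus identity** (`x ≥ 2`; for `q = 0` both sides carry Lean's junk value `x/φ(0) = 0`):
`ψ(x; q, a) − x/φ(q) = (π(x; q, a) − π(x)/φ(q)) log x − ∫_2^x (π(t; q, a) − π(t)/φ(q)) dt/t
  + (ϑ(x) − x)/φ(q) + (proper prime powers)`,
by Abel summation for `ϑ(x; q, a)` and for `ϑ(x)` (Mathlib). [folklore] -/
theorem chebyshevPsiMod_sub_eq {q : ℕ} (a : ℤ) {x : ℝ} (hx : 2 ≤ x) :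
    LevelOfDistribution.chebyshevPsiMod q (a : ZMod q) x - x / q.totient =
      (piMod q (a : ZMod q) x - (Nat.primeCounting ⌊x⌋₊ : ℝ) / q.totient) * Real.log x
      - (∫ t in (2 : ℝ)..x,
          (piMod q (a : ZMod q) t - (Nat.primeCounting ⌊t⌋₊ : ℝ) / q.totient) / t)
      + (Chebyshev.theta x - x) / q.totient + chebyshevPsiModNotPrime q (a : ZMod q) ⌊x⌋₊ := by
  have hx0 : (0 : ℝ) < x := by linarith
  rw [chebyshevPsiMod_eq_thetaMod_add, thetaMod_eq_piMod_mul_log_sub_integral _ _ hx]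
  have hθ := Chebyshev.theta_eq_primeCounting_mul_log_sub_integral hx
  have hI : (∫ t in (2 : ℝ)..x,
      (piMod q (a : ZMod q) t - (Nat.primeCounting ⌊t⌋₊ : ℝ) / q.totient) / t) =
      (∫ t in (2 : ℝ)..x, piMod q (a : ZMod q) t / t) -
        (∫ t in (2 : ℝ)..x, (Nat.primeCounting ⌊t⌋₊ : ℝ) / t) / q.totient := by
    rw [← intervalIntegral.integral_div, ← intervalIntegral.integral_sub
      (intervalIntegrable_piMod_div q _ two_pos hx0)
      ((intervalIntegrable_primeCounting_div two_pos hx0).div_const _)]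
    refine intervalIntegral.integral_congr fun t _ => ?_
    ring
  rw [hI, hθ]
  ring

/-- **The summed identity** (`x ≥ 2`): with `B(t) = bfiSum Qn a λ t`,
`∑_{q} λ(q) (ψ(x; q, a) − x/φ(q)) = B(x) log x − ∫_2^x B(t) dt/t + (ϑ(x) − x) ∑_q λ(q)/φ(q)
  + ∑_q λ(q) (proper prime powers)_q`. [folklore] -/
theorem weighted_sum_eq (Qn : ℕ) (a : ℤ) (lam : ℕ → ℝ) {x : ℝ} (hx : 2 ≤ x) :
    ∑ q ∈ moduli Qn a, lam q * (LevelOfDistribution.chebyshevPsiMod q (a : ZMod q) x - x / q.totient) =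
      bfiSum Qn a lam x * Real.log x - (∫ t in (2 : ℝ)..x, bfiSum Qn a lam t / t)
      + (Chebyshev.theta x - x) * ∑ q ∈ moduli Qn a, lam q / q.totient
      + ∑ q ∈ moduli Qn a, lam q * chebyshevPsiModNotPrime q (a : ZMod q) ⌊x⌋₊ := by
  have hx0 : (0 : ℝ) < x := by linarith
  have h1 : ∀ q ∈ moduli Qn a, lam q * (LevelOfDistribution.chebyshevPsiMod q (a : ZMod q) x - x / q.totient) =
      lam q * (piMod q (a : ZMod q) x - (Nat.primeCounting ⌊x⌋₊ : ℝ) / q.totient) * Real.log x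
      - (∫ t in (2 : ℝ)..x,
          lam q * ((piMod q (a : ZMod q) t - (Nat.primeCounting ⌊t⌋₊ : ℝ) / q.totient) / t))
      + (Chebyshev.theta x - x) * (lam q / q.totient)
      + lam q * chebyshevPsiModNotPrime q (a : ZMod q) ⌊x⌋₊ := by
    intro q _
    rw [chebyshevPsiMod_sub_eq a hx, intervalIntegral.integral_const_mul]
    ring
  have h2 : ∑ q ∈ moduli Qn a, (∫ t in (2 : ℝ)..x,
      lam q * ((piMod q (a : ZMod q) t - (Nat.primeCounting ⌊t⌋₊ : ℝ) / q.totient) / t)) =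
      ∫ t in (2 : ℝ)..x, bfiSum Qn a lam t / t := by
    rw [← intervalIntegral.integral_finsetSum (μ := volume)
      (f := fun (q : ℕ) (t : ℝ) =>
        lam q * ((piMod q (a : ZMod q) t - (Nat.primeCounting ⌊t⌋₊ : ℝ) / q.totient) / t))
      fun q _ => (intervalIntegrable_piMod_sub_div q _ two_pos hx0).const_mul (lam q)]
    refine intervalIntegral.integral_congr fun t _ => ?_
    simp only [bfiSum, Finset.sum_div, mul_div_assoc]
  rw [Finset.sum_congr rfl h1, Finset.sum_add_distrib, Finset.sum_add_distrib,
    Finset.sum_sub_distrib, ← Finset.sum_mul, ← Finset.mul_sum, h2, bfiSum]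

/-! ### Bounds for the four terms of the summed identity -/

/-- **The integral term.** If `|B(t)| ≤ M t` on `[t₁, x]` (the BFI range) then, with the trivial
bound below `t₁`,
`|∫_2^x B(t) dt/t| ≤ 2 (1 + log Qn)² t₁ + Qn log t₁ + M x`. [folklore] -/
theorem abs_integral_bfiSum_div_le (Qn : ℕ) (a : ℤ) {lam : ℕ → ℝ} (hlam : ∀ q, |lam q| ≤ 1)
    {t₁ x M : ℝ} (h2 : 2 ≤ t₁) (ht₁x : t₁ ≤ x) (hM : 0 ≤ M)
    (hB : ∀ t, t₁ ≤ t → t ≤ x → |bfiSum Qn a lam t| ≤ M * t) :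
    |∫ t in (2 : ℝ)..x, bfiSum Qn a lam t / t| ≤
      2 * (1 + Real.log Qn) ^ 2 * t₁ + Qn * Real.log t₁ + M * x := by
  have ht0 : 0 < t₁ := by linarith
  have hx0 : 0 < x := by linarith
  set L := Real.log Qn with hL
  have hL0 : 0 ≤ L := Real.log_natCast_nonneg Qn
  rw [← intervalIntegral.integral_add_adjacent_intervals (b := t₁)
    (intervalIntegrable_bfiSum_div Qn a lam two_pos ht0)
    (intervalIntegrable_bfiSum_div Qn a lam ht0 hx0)]
  have hI₁ : |∫ t in (2 : ℝ)..t₁, bfiSum Qn a lam t / t| ≤ 2 * (1 + L) ^ 2 * t₁ + Qn * Real.log t₁ := by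
    have hg : IntervalIntegrable (fun t : ℝ => 2 * (1 + L) ^ 2 + Qn * t⁻¹) volume 2 t₁ :=
      intervalIntegrable_const.add
        (((continuousOn_inv_uIcc two_pos ht0).intervalIntegrable).const_mul _)
    have hbound : ∀ᵐ t ∂volume, t ∈ Set.Ioc 2 t₁ →
        ‖bfiSum Qn a lam t / t‖ ≤ 2 * (1 + L) ^ 2 + Qn * t⁻¹ := by
      refine ae_of_all _ fun t ht => ?_
      obtain ⟨ht2, _⟩ := ht
      have ht' : 0 < t := by linarith
      rw [Real.norm_eq_abs, abs_div, abs_of_pos ht', div_le_iff₀ ht']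
      refine (abs_bfiSum_le_trivial Qn a hlam ht'.le).trans (le_of_eq ?_)
      rw [hL]
      field_simp
    have hle := intervalIntegral.norm_integral_le_of_norm_le h2 hbound hg
    rw [Real.norm_eq_abs] at hle
    refine hle.trans ?_
    rw [intervalIntegral.integral_add intervalIntegrable_const
        (((continuousOn_inv_uIcc two_pos ht0).intervalIntegrable).const_mul _),
      intervalIntegral.integral_const, intervalIntegral.integral_const_mul,
      integral_inv_of_pos two_pos ht0, smul_eq_mul]
    have hlog : Real.log (t₁ / 2) ≤ Real.log t₁ :=
      Real.log_le_log (by positivity) (by linarith)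
    have hQ : (0 : ℝ) ≤ Qn := Nat.cast_nonneg _
    nlinarith [mul_le_mul_of_nonneg_left hlog hQ, sq_nonneg (1 + L)]
  have hI₂ : |∫ t in t₁..x, bfiSum Qn a lam t / t| ≤ M * x := by
    have hle := intervalIntegral.norm_integral_le_of_norm_le_const (a := t₁) (b := x) (C := M)
      (f := fun t : ℝ => bfiSum Qn a lam t / t) fun t ht => ?bound2
    case bound2 =>
      rw [Set.uIoc_of_le ht₁x] at ht
      obtain ⟨ht1, _⟩ := ht
      have ht' : 0 < t := by linarith
      rw [Real.norm_eq_abs, abs_div, abs_of_pos ht', div_le_iff₀ ht']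
      exact hB t ht1.le ‹_›
    rw [Real.norm_eq_abs] at hle
    refine hle.trans ?_
    rw [abs_of_nonneg (by linarith)]
    nlinarith
  calc |(∫ t in (2 : ℝ)..t₁, bfiSum Qn a lam t / t) + ∫ t in t₁..x, bfiSum Qn a lam t / t|
      ≤ |∫ t in (2 : ℝ)..t₁, bfiSum Qn a lam t / t| + |∫ t in t₁..x, bfiSum Qn a lam t / t| :=
        abs_add_le _ _
    _ ≤ _ := by linarith

/-- Powers of `log` against powers of `x`: for `A, s ≥ 0`, `η > 0` there is `D ≥ 0` with
`(log x)^s x^{1−η} ≤ D · x/(log x)^A` for all `x > 1` (from `log y ≤ y^c/c`). [folklore] -/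
theorem exists_log_rpow_mul_rpow_le {A s η : ℝ} (hA : 0 ≤ A) (hs : 0 ≤ s) (hη : 0 < η) :
    ∃ D : ℝ, 0 ≤ D ∧ ∀ x : ℝ, 1 < x →
      Real.log x ^ s * x ^ (1 - η) ≤ D * (x / Real.log x ^ A) := by
  -- first `(log x)^κ ≤ D x^η` for `κ = s + A` (stockroom `log_rpow_le_const_mul_rpow`)
  set κ := s + A with hκdef
  have hκ : 0 ≤ κ := by positivity
  set c : ℝ := η / (κ + 1) with hc_def
  have hc : 0 < c := by positivity
  refine ⟨(c⁻¹) ^ κ, by positivity, fun x hx => ?_⟩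
  have hX : (1 : ℝ) ≤ x := hx.le
  have hX0 : (0 : ℝ) < x := by linarith
  have hlog0 : 0 < Real.log x := Real.log_pos hx
  have h1 : Real.log x ≤ x ^ c / c := by
    have h2 : Real.log (x ^ c) ≤ x ^ c - 1 := Real.log_le_sub_one_of_pos (Real.rpow_pos_of_pos hX0 c)
    rw [Real.log_rpow hX0] at h2
    rw [le_div_iff₀ hc]
    nlinarith
  have h4 : Real.log x ^ κ ≤ (x ^ c / c) ^ κ := Real.rpow_le_rpow hlog0.le h1 hκ
  have h5 : (x ^ c / c) ^ κ = (c⁻¹) ^ κ * x ^ (c * κ) := by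
    rw [div_eq_mul_inv, mul_comm, Real.mul_rpow (by positivity) (by positivity), ← Real.rpow_mul hX0.le]
  have h7 : x ^ (c * κ) ≤ x ^ η := by
    apply Real.rpow_le_rpow_of_exponent_le hX
    rw [hc_def, div_mul_eq_mul_div, div_le_iff₀ (by positivity : (0:ℝ) < κ + 1)]
    nlinarith
  have hmain : Real.log x ^ κ ≤ (c⁻¹) ^ κ * x ^ η :=
    h4.trans (h5.le.trans (mul_le_mul_of_nonneg_left h7 (by positivity)))
  -- now divide by `(log x)^A` and multiply by `x^{1-η}`
  have hsplit : Real.log x ^ κ = Real.log x ^ s * Real.log x ^ A := by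
    rw [hκdef, Real.rpow_add hlog0]
  have hxsplit : x = x ^ η * x ^ (1 - η) := by
    rw [← Real.rpow_add hX0]; norm_num
  have hLA : 0 < Real.log x ^ A := Real.rpow_pos_of_pos hlog0 A
  rw [mul_div_assoc', le_div_iff₀ hLA]
  calc Real.log x ^ s * x ^ (1 - η) * Real.log x ^ A
      = Real.log x ^ κ * x ^ (1 - η) := by rw [hsplit]; ring
    _ ≤ (c⁻¹) ^ κ * x ^ η * x ^ (1 - η) :=
        mul_le_mul_of_nonneg_right hmain (Real.rpow_nonneg hX0.le _)
    _ = (c⁻¹) ^ κ * x := by rw [mul_assoc, ← hxsplit]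

/-! ### BFI Theorem 10 feeds the integral: the level fits, and the log-loss is a constant -/

/-- BFI Theorem 10 (`π`-form) bounds `bfiSum`, with a nonnegative constant and a threshold `≥ 2`
(mere unfolding of `BombieriFriedlanderIwaniecTheorem10Pi` through `bfiSum_eq`). [folklore] -/
theorem abs_bfiSum_le_of_theorem10Pi (h10 : BombieriFriedlanderIwaniecTheorem10Pi) {a : ℤ}
    (ha : a ≠ 0) {A : ℝ} (hA : 0 < A) {ε : ℝ} (hε : 0 < ε) :
    ∃ C x₀ : ℝ, 0 ≤ C ∧ 2 ≤ x₀ ∧ ∀ t : ℝ, x₀ ≤ t → ∀ Q : ℝ, Q ≤ t ^ (4 / 7 - ε) →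
      ∀ lam : ℕ → ℝ, IsWellFactorable Q lam →
        |bfiSum ⌊Q⌋₊ a lam t| ≤ C * t / Real.log t ^ A := by
  obtain ⟨C, x₀, hC, hx₀, h⟩ := h10.bound_nonneg ha hA hε
  refine ⟨C, x₀, hC, hx₀, fun t ht Q hQ lam hlam => ?_⟩
  rw [bfiSum_eq]
  exact h t ht Q hQ lam hlam

/-- **The level fits in the BFI range along the integral.** For `0 ≤ 4/7 − ε`, `x ≥ 1` and
`t ≥ x^{1 − ε/2}` one has `x^{4/7 − ε} ≤ t^{4/7 − ε/2}` (because
`(1 − ε/2)(4/7 − ε/2) − (4/7 − ε) = 3ε/14 + ε²/4 ≥ 0`), so BFI Theorem 10 with `ε/2` in place of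
`ε` applies at every height `t ∈ [x^{1−ε/2}, x]` with the moduli range `q ≤ x^{4/7−ε}`. [folklore] -/
theorem rpow_level_le_rpow {ε x t : ℝ} (hε : 0 < ε) (hγ : 0 ≤ 4 / 7 - ε) (hx : 1 ≤ x)
    (ht : x ^ (1 - ε / 2) ≤ t) : x ^ (4 / 7 - ε) ≤ t ^ (4 / 7 - ε / 2) := by
  have hx0 : 0 ≤ x := by linarith
  have hexp : 0 ≤ 4 / 7 - ε / 2 := by linarith
  calc x ^ (4 / 7 - ε) ≤ x ^ ((1 - ε / 2) * (4 / 7 - ε / 2)) := by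
        apply Real.rpow_le_rpow_of_exponent_le hx
        nlinarith
    _ = (x ^ (1 - ε / 2)) ^ (4 / 7 - ε / 2) := Real.rpow_mul hx0 _ _
    _ ≤ t ^ (4 / 7 - ε / 2) := Real.rpow_le_rpow (Real.rpow_nonneg hx0 _) ht hexp

/-- Along `t ∈ [x^{1−η}, x]` (`x > 1`, `0 < η < 1`) the saving `1/(log t)^B` is at most
`(1 − η)^{−B}/(log x)^B` (`B ≥ 0`). [folklore] -/
theorem div_log_rpow_le {x t η B C : ℝ} (hx : 1 < x) (hη : η < 1) (ht : x ^ (1 - η) ≤ t)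
    (hB : 0 ≤ B) (hC : 0 ≤ C) (ht0 : 0 ≤ t) :
    C * t / Real.log t ^ B ≤ C / (1 - η) ^ B * t / Real.log x ^ B := by
  have hx0 : 0 < x := by linarith
  have hL : 0 < Real.log x := Real.log_pos hx
  have hlogt₁ : Real.log (x ^ (1 - η)) = (1 - η) * Real.log x := Real.log_rpow hx0 _
  have ht₁pos : 0 < x ^ (1 - η) := Real.rpow_pos_of_pos hx0 _
  have hlogt : (1 - η) * Real.log x ≤ Real.log t := by
    rw [← hlogt₁]; exact Real.log_le_log ht₁pos ht
  have hpos : 0 < (1 - η) * Real.log x := mul_pos (by linarith) hL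
  have hpow : ((1 - η) * Real.log x) ^ B ≤ Real.log t ^ B := Real.rpow_le_rpow hpos.le hlogt hB
  have hpowpos : 0 < ((1 - η) * Real.log x) ^ B := Real.rpow_pos_of_pos hpos B
  calc C * t / Real.log t ^ B ≤ C * t / ((1 - η) * Real.log x) ^ B := by
        apply div_le_div_of_nonneg_left (by positivity) hpowpos hpow
    _ = C / (1 - η) ^ B * t / Real.log x ^ B := by
        rw [Real.mul_rpow (by linarith) hL.le]
        field_simp

end BFIReduction

open BFIReduction in
/-- **BFI Theorem 10, `ψ`-form for families, from the `π`-form.**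
`BombieriFriedlanderIwaniecTheorem10Pi` (the `π`-form of Bombieri–Friedlander–Iwaniec, Acta Math.
156 (1986), Theorem 10, as restated in Maynard, arXiv:2006.07088, p. 3:
`∑_{(q,a)=1} λ(q)(π(x;q,a) − π(x)/φ(q)) ≪_{a,A,ε} x/(log x)^A` uniformly over well-factorable `λ` of
level `Q ≤ x^{4/7−ε}`) together with the prime number theorem with the de la Vallée Poussin error
term (`ChebyshevThetaDeLaValleePoussin`, Montgomery–Vaughan Thm 6.9) implies
`bfi_wellFactorable_level = PrimesHaveWellFactorableLevel (4/7)`, the `ψ`-form with expected value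
`x/φ(q)` for families `λ_x` of level `x^{4/7−ε}` (the form printed in BFI 1986).
Proof: for `x ≥ 2`, `∑_q λ_x(q)(ψ(x;q,a) − x/φ(q)) = B(x) log x − ∫_2^x B(t) dt/t + (ϑ(x) − x) ∑_q λ_x(q)/φ(q)
+ ∑_q λ_x(q) PP_q(x)` (`weighted_sum_eq`, Abel summation), where `B(t)` is the BFI sum at height `t`
with the moduli range `q ≤ x^{4/7−ε}`. The `π`-form with `(A+1, ε/2)` bounds `B(x)` and `B(t)` for
`t ≥ x^{1−ε/2}` (`rpow_level_le_rpow`); below `x^{1−ε/2}` the trivial bound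
`|B(t)| ≤ 2t(1 + log x)² + x^{4/7}` suffices; `|ϑ(x) − x| ∑ 1/φ(q) ≪ x (log x)^{2−A−2}`; and the
proper prime powers contribute at most `∑_{q ≤ x^{4/7}} max_{(b,q)=1} PP_{q,b}(x) ≤ x/(log x)^A`
(`eventually_sum_iSup_chebyshevPsiModNotPrime_le`, the averaged prime-power bound of
`PrimePowersInProgressions`, applicable since `x^{4/7} = x^{1−3/7}`). This is the standard
partial-summation equivalence of the `π`- and `ψ`-forms (Iwaniec–Kowalski §17.1).
[cite: IwaniecKowalski2004, §17.1] -/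
theorem bfi_wellFactorable_level_of_theorem10Pi (h10 : BombieriFriedlanderIwaniecTheorem10Pi)
    (hθ : LFunctions.ChebyshevThetaDeLaValleePoussin) : bfi_wellFactorable_level := by
  intro a ha A hA ε hε lam hlam
  set γ : ℝ := 4 / 7 - ε with hγ
  rcases lt_or_ge γ 0 with hγ0 | hγ0
  · -- degenerate case `4/7 − ε < 0`: for `x > 1` the moduli range `q ≤ x^γ < 1` is empty
    refine IsBigO.of_bound 0 ?_
    filter_upwards [eventually_gt_atTop 1] with x hx
    have hfloor : ⌊x ^ γ⌋₊ = 0 := Nat.floor_eq_zero.mpr (Real.rpow_lt_one_of_one_lt_of_neg hx hγ0)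
    rw [hfloor]
    simp
  -- main case `0 ≤ γ = 4/7 − ε`; put `η = ε/2 < 1`
  set η : ℝ := ε / 2 with hη
  have hη0 : 0 < η := by positivity
  have hη1 : η < 1 := by rw [hη]; linarith
  have h1η : 0 < 1 - η := by linarith
  -- the constants
  obtain ⟨C₂, x₂, hC₂, hx₂, H10⟩ := abs_bfiSum_le_of_theorem10Pi h10 ha (by linarith : 0 < A + 1) hη0
  obtain ⟨C₃, H3⟩ := hθ.logPow (A + 2)
  obtain ⟨D₁, hD₁, HD1⟩ := exists_log_rpow_mul_rpow_le hA.le (by norm_num : (0:ℝ) ≤ 2) hη0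
  obtain ⟨D₂, hD₂, HD2⟩ :=
    exists_log_rpow_mul_rpow_le hA.le (by norm_num : (0:ℝ) ≤ 1) (by norm_num : (0:ℝ) < 3 / 7)
  set C₃' : ℝ := max C₃ 0 with hC₃'
  have hC₃'0 : 0 ≤ C₃' := le_max_right _ _
  set M₀ : ℝ := C₂ / (1 - η) ^ (A + 1) with hM₀
  have hM₀0 : 0 ≤ M₀ := by positivity
  set K : ℝ := C₂ + (8 * D₁ + D₂ + M₀) + 4 * C₃' + 1 with hK
  refine IsBigO.of_bound K ?_
  -- thresholds in `x`
  have hev₁ : ∀ᶠ x : ℝ in atTop, x₂ ≤ x ^ (1 - η) :=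
    (tendsto_rpow_atTop h1η).eventually_ge_atTop x₂
  filter_upwards [hev₁, eventually_ge_atTop (Real.exp 1),
    eventually_sum_iSup_chebyshevPsiModNotPrime_le (by norm_num : (0:ℝ) < 3 / 7) A]
    with x hx₁ hxe hPP
  -- basic facts about `x`
  have hx2 : (2 : ℝ) ≤ x := le_trans (by linarith [Real.add_one_le_exp (1 : ℝ)]) hxe
  have hx1 : (1 : ℝ) < x := by linarith
  have hx1' : (1 : ℝ) ≤ x := hx1.le
  have hx0 : (0 : ℝ) < x := by linarith
  set L : ℝ := Real.log x with hLdef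
  have hL1 : 1 ≤ L := by
    rw [hLdef, ← Real.log_exp 1]; exact Real.log_le_log (Real.exp_pos 1) hxe
  have hL0 : 0 < L := by linarith
  have hLA : 0 < L ^ A := Real.rpow_pos_of_pos hL0 A
  set X : ℝ := x / L ^ A with hXdef
  have hX0 : 0 < X := div_pos hx0 hLA
  -- the level and the moduli
  set Qn : ℕ := ⌊x ^ γ⌋₊ with hQn
  have hxγ0 : 0 ≤ x ^ γ := Real.rpow_nonneg hx0.le γ
  have hQnle : (Qn : ℝ) ≤ x ^ γ := Nat.floor_le hxγ0
  have hγ47 : x ^ γ ≤ x ^ (4 / 7 : ℝ) := Real.rpow_le_rpow_of_exponent_le hx1' (by linarith)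
  have hγx : x ^ γ ≤ x := by
    refine (Real.rpow_le_rpow_of_exponent_le hx1' (show γ ≤ 1 by linarith)).trans ?_
    rw [Real.rpow_one]
  have hQnx : (Qn : ℝ) ≤ x := hQnle.trans hγx
  have hlogQn0 : 0 ≤ Real.log Qn := Real.log_natCast_nonneg Qn
  have hlogQn : Real.log Qn ≤ L := by
    rcases Nat.eq_zero_or_pos Qn with h0 | hpos
    · rw [h0, Nat.cast_zero, Real.log_zero]; exact hL0.le
    · exact Real.log_le_log (by exact_mod_cast hpos) hQnx
  have hlogQn2 : (1 + Real.log Qn) ^ 2 ≤ 4 * L ^ 2 := by nlinarith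
  -- the weights at `x`
  have hlam1 : ∀ q, |lam x q| ≤ 1 := fun q => (hlam x).abs_le_one q
  -- `t₁ = x^{1-η}`
  set t₁ : ℝ := x ^ (1 - η) with ht₁
  have ht₁2 : 2 ≤ t₁ := hx₂.trans hx₁
  have ht₁x : t₁ ≤ x := by
    refine (Real.rpow_le_rpow_of_exponent_le hx1' (show 1 - η ≤ 1 by linarith)).trans ?_
    rw [Real.rpow_one]
  have hx₂x : x₂ ≤ x := hx₁.trans ht₁x
  have hlogt₁ : Real.log t₁ = (1 - η) * L := Real.log_rpow hx0 _
  have hlogt₁L : Real.log t₁ ≤ L := by rw [hlogt₁]; nlinarith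
  have hlogt₁0 : 0 ≤ Real.log t₁ := Real.log_nonneg (by linarith)
  -- power bookkeeping
  have hLA1 : L ^ (A + 1) = L ^ A * L := Real.rpow_add_one hL0.ne' A
  have hLA2 : L ^ (A + 2) = L ^ A * L ^ 2 := by
    rw [Real.rpow_add hL0, Real.rpow_two]
  have HD1x : L ^ 2 * x ^ (1 - η) ≤ D₁ * X := by
    have := HD1 x hx1; rwa [Real.rpow_two] at this
  have HD2x : L * x ^ (4 / 7 : ℝ) ≤ D₂ * X := by
    have := HD2 x hx1; rwa [Real.rpow_one, show (1 : ℝ) - 3 / 7 = 4 / 7 by norm_num] at this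
  -- (T1) the boundary term `B(x) log x`
  have hT1 : |bfiSum Qn a (lam x) x * L| ≤ C₂ * X := by
    have hQ : x ^ γ ≤ x ^ (4 / 7 - η) := Real.rpow_le_rpow_of_exponent_le hx1' (by linarith)
    have h := H10 x hx₂x (x ^ γ) hQ (lam x) (hlam x)
    rw [abs_mul, abs_of_pos hL0]
    calc |bfiSum Qn a (lam x) x| * L ≤ C₂ * x / L ^ (A + 1) * L :=
          mul_le_mul_of_nonneg_right h hL0.le
      _ = C₂ * X := by rw [hLA1, hXdef]; field_simp
  -- (T2) the integral term
  have hT2 : |∫ t in (2 : ℝ)..x, bfiSum Qn a (lam x) t / t| ≤ (8 * D₁ + D₂ + M₀) * X := by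
    set M : ℝ := M₀ / L ^ (A + 1) with hM
    have hM0 : 0 ≤ M := by positivity
    have hB : ∀ t, t₁ ≤ t → t ≤ x → |bfiSum Qn a (lam x) t| ≤ M * t := by
      intro t ht₁t htx
      have hx₂t : x₂ ≤ t := hx₁.trans ht₁t
      have ht0 : 0 ≤ t := by linarith
      have hQ : x ^ γ ≤ t ^ (4 / 7 - η) := rpow_level_le_rpow hε hγ0 hx1' ht₁t
      have h := H10 t hx₂t (x ^ γ) hQ (lam x) (hlam x)
      refine h.trans ((div_log_rpow_le hx1 hη1 ht₁t (by linarith) hC₂ ht0).trans (le_of_eq ?_))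
      rw [hM, hM₀, ← hLdef]
      field_simp
    have h := abs_integral_bfiSum_div_le Qn a hlam1 ht₁2 ht₁x hM0 hB
    refine h.trans ?_
    have e1 : 2 * (1 + Real.log Qn) ^ 2 * t₁ ≤ 8 * D₁ * X := by
      have ht₁0 : 0 ≤ t₁ := by linarith
      calc 2 * (1 + Real.log Qn) ^ 2 * t₁ ≤ 2 * (4 * L ^ 2) * t₁ := by gcongr
        _ = 8 * (L ^ 2 * x ^ (1 - η)) := by rw [ht₁]; ring
        _ ≤ 8 * (D₁ * X) := by gcongr
        _ = 8 * D₁ * X := by ring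
    have e2 : (Qn : ℝ) * Real.log t₁ ≤ D₂ * X := by
      calc (Qn : ℝ) * Real.log t₁ ≤ x ^ (4 / 7 : ℝ) * L :=
            mul_le_mul (hQnle.trans hγ47) hlogt₁L hlogt₁0 (Real.rpow_nonneg hx0.le _)
        _ = L * x ^ (4 / 7 : ℝ) := mul_comm _ _
        _ ≤ D₂ * X := HD2x
    have e3 : M * x ≤ M₀ * X := by
      rw [hM, hLA1, hXdef]
      rw [div_mul_eq_mul_div, div_le_iff₀ (by positivity)]
      calc M₀ * x = M₀ * (x / L ^ A) * (L ^ A * 1) := by field_simp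
        _ ≤ M₀ * (x / L ^ A) * (L ^ A * L) := by gcongr
    linarith
  -- (T3) the prime number theorem term
  have hT3 : |(Chebyshev.theta x - x) * ∑ q ∈ moduli Qn a, lam x q / q.totient| ≤ 4 * C₃' * X := by
    have hθx : |Chebyshev.theta x - x| ≤ C₃' * x / L ^ (A + 2) := by
      refine (H3 x hx2).trans ?_
      gcongr
      exact le_max_left _ _
    have hS : |∑ q ∈ moduli Qn a, lam x q / q.totient| ≤ (1 + Real.log Qn) ^ 2 := by
      refine (Finset.abs_sum_le_sum_abs _ _).trans ?_
      refine le_trans ?_ (Sieve.totientInvSum_le Qn)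
      refine le_trans (Finset.sum_le_sum fun q _ => ?_)
        (Finset.sum_le_sum_of_subset_of_nonneg (moduli_subset Qn a) fun q _ _ => by positivity)
      rw [abs_div, Nat.abs_cast, div_eq_mul_inv]
      exact mul_le_of_le_one_left (by positivity) (hlam1 q)
    rw [abs_mul]
    calc |Chebyshev.theta x - x| * |∑ q ∈ moduli Qn a, lam x q / q.totient|
        ≤ (C₃' * x / L ^ (A + 2)) * (4 * L ^ 2) :=
          mul_le_mul hθx (hS.trans hlogQn2) (abs_nonneg _) (by positivity)
      _ = 4 * C₃' * X := by rw [hLA2, hXdef]; field_simp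
  -- (T4) the proper prime powers, on average over `q ≤ Qn ≤ x^{4/7} = x^{1 − 3/7}` (tree input)
  have hT4 : |∑ q ∈ moduli Qn a, lam x q * chebyshevPsiModNotPrime q (a : ZMod q) ⌊x⌋₊| ≤ 1 * X := by
    have hQn47 : (Qn : ℝ) ≤ x ^ (1 - 3 / 7 : ℝ) := by
      rw [show (1 : ℝ) - 3 / 7 = 4 / 7 by norm_num]; exact hQnle.trans hγ47
    calc |∑ q ∈ moduli Qn a, lam x q * chebyshevPsiModNotPrime q (a : ZMod q) ⌊x⌋₊|
        ≤ ∑ q ∈ moduli Qn a, |lam x q * chebyshevPsiModNotPrime q (a : ZMod q) ⌊x⌋₊| :=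
          Finset.abs_sum_le_sum_abs _ _
      _ ≤ ∑ q ∈ moduli Qn a, ⨆ b : (ZMod q)ˣ, chebyshevPsiModNotPrime q b ⌊x⌋₊ := by
          refine Finset.sum_le_sum fun q hq => ?_
          have hcop : IsCoprime (q : ℤ) a := (Finset.mem_filter.mp hq).2
          obtain ⟨u, hu⟩ := (ZMod.coe_int_isUnit_iff_isCoprime a q).mpr hcop
          rw [abs_mul, abs_of_nonneg (chebyshevPsiModNotPrime_nonneg _ _ _)]
          refine (mul_le_of_le_one_left (chebyshevPsiModNotPrime_nonneg _ _ _) (hlam1 q)).trans ?_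
          rw [← hu]
          exact chebyshevPsiModNotPrime_le_iSup u _
      _ ≤ ∑ q ∈ Icc 1 Qn, ⨆ b : (ZMod q)ˣ, chebyshevPsiModNotPrime q b ⌊x⌋₊ :=
          Finset.sum_le_sum_of_subset_of_nonneg (moduli_subset Qn a) fun q _ _ =>
            iSup_chebyshevPsiModNotPrime_nonneg q _
      _ ≤ 1 * X := by rw [one_mul]; exact hPP Qn hQn47
  -- assemble
  have hsum : (∑ q ∈ (Icc 1 ⌊x ^ γ⌋₊).filter (fun q : ℕ => IsCoprime (q : ℤ) a),
      lam x q * (LevelOfDistribution.chebyshevPsiMod q (a : ZMod q) x - x / Nat.totient q)) =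
      ∑ q ∈ moduli Qn a, lam x q * (LevelOfDistribution.chebyshevPsiMod q (a : ZMod q) x - x / q.totient) := rfl
  rw [Real.norm_eq_abs, Real.norm_eq_abs, hsum, weighted_sum_eq Qn a (lam x) hx2,
    abs_of_pos hX0]
  have habs : ∀ P I T S : ℝ, |P - I + T + S| ≤ |P| + |I| + |T| + |S| := by
    intro P I T S
    have h1 := abs_add_le (P - I + T) S
    have h2 := abs_add_le (P - I) T
    have h3 := abs_sub P I
    linarith
  refine (habs _ _ _ _).trans ?_
  have hKX : K * X = C₂ * X + (8 * D₁ + D₂ + M₀) * X + 4 * C₃' * X + 1 * X := by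
    rw [hK]; ring
  rw [hKX]
  exact add_le_add (add_le_add (add_le_add hT1 hT2) hT3) hT4

end Literature.NumberTheory.Sieve
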